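/-
Copyright: lit-balaban cell, Phase-2 proof seat p11 (gen 4).  Skeleton of a published paper; no claims beyond what the kernel checks.
-/
import Literature.MathematicalPhysics.QuantumFieldTheory.BalabanImbrieJaffe1984to88.BIJ85FluctuationCovariance
import Literature.MathematicalPhysics.QuantumFieldTheory.BalabanImbrieJaffe1984to88.BIJ85Ineq732Flat
import Literature.MathematicalPhysics.QuantumFieldTheory.Balaban1983to89.Beta.CoordCubePoincare

/-!
# `BalabanImbrieJaffe1984to88.BIJ85FluctuationCovarianceFlatBounds` — T. Bałaban, J. Imbrie, A. Jaffe, *Renormalization of the Higgs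
model: minimizers, propagators and the stability of mean field theory*, Commun. Math. Phys. **97** (1985) 299–329 [BalabanImbrieJaffe1985],
p. 301 *"uniform stability estimates (strictly positive lower bounds)"* for the scalar fluctuation form of Sect. 4.6 p. 313, i.e. [3] =
[Balaban1982Higgs1] Prop. 2.3 **(2.33) `γ₀I ≤ a′P + Δ_k ≤ γ₁I` — PROVED AT THE FLAT BACKGROUND on the torus model of record, with
explicit `γ₀ = γ₀(a, a′, d, L)`, `γ₁ = a′L^{−d} + a_k`, UNIFORM IN `k ≥ 1`, IN `j` AND IN THE VOLUME**, from a one-level block Poincaré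
inequality on the torus and gen 4's (7.3.2)-at-the-flat-background; the upper bound at EVERY background; consequences
`γ₁^{−1} ≤ C^{(k)}(1) ≤ γ₀^{−1}`, `‖C^{(k)}(1)‖ ≤ γ₀^{−1}` for the fluctuation covariance of `BIJ85FluctuationCovariance`.

statement-level skeleton of published theorems with citation tags; proofs where landed; nothing here is a claim about the Yang–Mills mass gap

PDF held: `paper:balaban1985-cmp97-bij-higgs-minimizers` (journal page = PDF page + 298), pp. 301, 303, 313 [PDF 3, 5, 15]; [3] =
`paper:balaban1982-cmp85-higgs23-i` (journal page = PDF page + 602), p. 611 [PDF 9] (`lit read`, this session).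

CITATION HEADER (lean-in-tree rule).  Phase-2 file of the lit-balaban TYPED SKELETON (HOME `run/shared/lean/pub/lit-balaban/`), seat p11
gen 4 (unit `lit-balaban-p11-g4`; TAKING line HOME/STATUS.md 2026-08-21T07:15:54Z; owner r15, referee ref-5; own lane = the C1 scalar sector
§4.6).  WHAT IS REPRODUCED: row **C1.Eq4.6.2-4.6.4**, last clause (*"The other propagators such as C^{(k)}(u_k) are defined as in [3]"*) and
the programme sentence of p. 301 (row **C1.Eq1.4**, prose), KNITTED with row **B1.Prop2.3** (owner r14; typed abstractly as `B1.Prop23Literal` /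
`B4.Prop23Printed`; `B1RG242Torus`: *"(2.33) (uniform bounds γ₀, γ₁) … untouched"*) — kind «model-instance»: clause (2.33) alone, at `A = 0`,
`Ω = Λ =` the torus, on the C1 carriers.  No decl of record restated; `Beta.CoordCubePoincare` (pub-balaban cell) consumed BY NAME.

THE PRINTED TEXT, verbatim.  C1 p. 301 [PDF 3]: *"We study the quadratic terms which arise by iteration of the renormalization
transformation, yielding S_{Q1}, S_{Q2}, …, S_{Qk}, and establish uniform stability estimates (strictly positive lower bounds) on the
S_Q's."*  p. 313 [PDF 15]: *"The other propagators such as C^{(k)}(u_k) are defined as in [3] with the only change that the background gauge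
field is u_k."*  [3] p. 611 [PDF 9]: *"C^{(k)}(Ω, A) = (aL^{−2}P(A) + Δ^{(k)}(Ω, A))^{−1}. (2.31) … Proposition 2.3. If a configuration A
is regular on Ω in the sense defined in Proposition 2.1, then there exist positive constants δ₀, c₀, γ₀, γ₁, dependent on d and a, and
independent of A, k, Ω and Λ, such that γ₀I ≤ aL^{−2}P(A) + Δ^{(k)}(Ω, A) ≤ γ₁I, (2.33) …"*  p. 303 [PDF 5]: *"QQ^* = I … (2.9) … Q is a
partial isometry."*

WHAT IS PROVED (0 `sorry`, standard axioms; carriers of record of gens 2–4: `FineSp`, `CoarseSpK`, `Qlin`, `QlinK`, `Dlin`, `deltaOp`,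
`covOp`, `bondForm`, `cPhys`, the printed `a_k = BIJ85Sect4Statements.aK`).
* §1 **`norm_sq_le_blockAvg_add_bondSum`** — ONE-LEVEL BLOCK POINCARÉ ON THE TORUS `T^{(i)}`, `i + 1 ≤ m + K`: `‖φ‖² ≤ L^d‖Q(1)φ‖² +
  (L(L−1)/2)·Σ_b|φ(b₊) − φ(b₋)|²` (Steiner on each block, `|B(y)| = L^d`, flat average = block mean, cube Poincaré charted by `Site.blockSite`).
* §2 `gamma0 a a′ d L = min(a′/L^d, 2·min(a/(9d), ½)/(L(L−1)))` > 0; **`coercive_flat`**: for `1 ≤ k`, `j + k + 1 ≤ m + K`, `a, a′ > 0`,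
  `G = G_k(1)` the inverse of (4.6.2) (physical normalization `cPhys`, printed `a_k`) and every `ψ`:
  `γ₀‖ψ‖² ≤ a′‖Q(1)ψ‖² + ⟨ψ, Δ_k(1)ψ⟩` (Poincaré + `BIJ85Ineq732Flat.ineq732_flat_phys`); `coercive_covOp_flat`: the same for
  `⟨ψ, (a′Q^*Q + Δ_k(1))ψ⟩` (`BIJ85FluctuationCovariance.covOp`, `lineIter 1 k = 1`).
* §3 `norm_Qlin_sq_le`: `‖Q(W)φ‖² ≤ L^{−d}‖φ‖²` for EVERY transport field `W` ((2.9) in unweighted norms); **`form_le`**: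
  `a′‖Q(W)ψ‖² + ⟨ψ, Δ_k(u)ψ⟩ ≤ (a′L^{−d} + a_k)‖ψ‖²` at EVERY background `u`, every `W`, `a_k, a′ ≥ 0`.
* §4 **`norm_C_le_flat`**: `‖C^{(k)}(1)ψ‖ ≤ γ₀^{−1}‖ψ‖`; **`inner_C_bounds_flat`**: `(a′L^{−d} + a_k)^{−1}‖ψ‖² ≤ ⟨ψ, C^{(k)}(1)ψ⟩ ≤ γ₀^{−1}‖ψ‖²`
  for every right inverse `C` of `a′Q^*Q + Δ_k(1)` (it exists: `BIJ85FluctuationCovariance.exists_C`; abstract Cauchy–Schwarz lemmas).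
HONEST SCOPE.  The lower bound is proved at the FLAT background `u = 1` only (`A = 0`, trivially regular); at a general regular background
(2.33) is NOT claimed (that needs (7.3.2) of C1 at general `u`, GAPS G-C1-05).  `γ₀` depends on `L` explicitly (the printed *"dependent
on d and a"* is silent about the fixed `L`); the constants are not optimal.  No kernel decay (2.34)–(2.38).  Massless C1 operator (4.6.2)
(no `m²` term, unlike [3] (2.17)); `k ≥ 1`; `a′ > 0` arbitrary (`aL^{−2}` in print); unweighted `ℓ²` norms of the carriers of record.
-/

open scoped RealInnerProductSpace BigOperators
open Finset

namespace Literature.MathematicalPhysics.QuantumFieldTheory.BalabanImbrieJaffe1984to88.BIJ85FluctuationCovarianceFlatBounds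

open Literature.MathematicalPhysics.QuantumFieldTheory.Balaban1983to89
open BIJ88Sect3Statements (U1 toC cfg covD)
open BIJ85Sect1Model (HiggsField)
open BIJ85BlockAveragesTorus BIJ85BlockAveragesTorusK BIJ85ScalarPropagatorTorus BIJ85ScalarPropagatorTorusK
open BIJ85ScalarForm464 BIJ85Eq461Proof BIJ85BlockAveragingIneq BIJ85Ineq732Flat BIJ85FluctuationCovariance
open Beta.BlockPoincare (avg sum_sq_eq_var_add)
open Beta.CoordCubePoincare (stepUp blockPoincare_of_charts)

noncomputable section

variable {P : Params} {i : ℕ}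

/-! ## §1. The one-level block Poincaré inequality on the torus -/

/-- `(L − 1) + 1 = L`. [folklore] -/
private theorem predL_succ (P : Params) : P.L - 1 + 1 = P.L := Nat.sub_add_cancel P.L_pos

/-- The block chart `{0,…,L−1}^d → B(y)` (offsets from the lowest label), on `Fin ((L−1)+1)`. [folklore] -/
private def chart (y : Balaban1983to89.Site P (i+1)) (r : Fin P.d → Fin (P.L - 1 + 1)) : Balaban1983to89.Site P i :=
  Balaban1983to89.Site.blockSite y (fun κ => (r κ).cast (predL_succ P))

/-- The chart is injective. [folklore] -/
private theorem chart_injective (hi : i + 1 ≤ P.m + P.K) (y : Balaban1983to89.Site P (i+1)) :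
    Function.Injective (chart (i := i) y) := by
  intro r r' h
  funext κ
  have hv := congrArg (fun x : Balaban1983to89.Site P i => (x κ).val) h
  simp only [chart, Balaban1983to89.Site.val_blockSite hi, Fin.val_cast, add_right_inj] at hv
  exact Fin.ext hv

/-- The charts are jointly onto. [folklore] -/
private theorem chart_surj (hi : i + 1 ≤ P.m + P.K) (x : Balaban1983to89.Site P i) :
    ∃ r, chart (blockOf x) r = x :=
  ⟨fun κ => (offs x κ).cast (predL_succ P).symm, by
    have h : (fun κ => ((offs x κ).cast (predL_succ P).symm).cast (predL_succ P)) = offs x := funext fun κ => Fin.ext rfl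
    simp only [chart, h]
    exact blockSite_offs hi x⟩

/-- A unit step inside the cube is a unit step on the torus. [folklore] -/
private theorem chart_stepUp (y : Balaban1983to89.Site P (i+1)) (r : Fin P.d → Fin (P.L - 1 + 1))
    (μ : Fin P.d) (hr : r μ ≠ Fin.last (P.L - 1)) : (chart y r).shift μ = chart y (stepUp r μ) := by
  funext κ
  simp only [Balaban1983to89.Site.shift, chart, Balaban1983to89.Site.blockSite, stepUp]
  by_cases hκ : κ = μ
  · subst hκ
    simp only [Function.update_self, Fin.val_cast, Fin.val_add_one, if_neg hr]
    push_cast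
    ring
  · simp only [Function.update_of_ne hκ, Balaban1983to89.Site.blockSite, Fin.val_cast]

/-- Block Poincaré for a real function on ONE block of the torus: `Beta.CoordCubePoincare.blockPoincare_of_charts` with the charts above and
the internal bonds listed by (direction, offset) (constant `(L−1)L/2`, bonds with both ends in the block). [folklore] -/
private theorem var_block_le (hi : i + 1 ≤ P.m + P.K) (y : Balaban1983to89.Site P (i+1)) (f : Balaban1983to89.Site P i → ℝ) :
    ∑ x ∈ block y, (f x - avg (block y) f) ^ 2
      ≤ ((P.L - 1 : ℕ) : ℝ) * ((P.L - 1 : ℕ) + 1) / 2 *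
        ∑ b ∈ univ.filter (fun b : PBond P i => blockOf b.src = y ∧ blockOf b.tgt = y), (f b.tgt - f b.src) ^ 2 := by
  classical
  exact blockPoincare_of_charts blockOf PBond.src PBond.tgt (P.L - 1) P.d chart
    (fun y _ => Balaban1983to89.Site.blockOf_blockSite hi y _) (chart_injective hi) (chart_surj hi) (fun y μ r => ⟨chart y r, μ⟩)
    (fun _ _ _ _ => rfl) (fun y μ r hr => chart_stepUp y r μ hr)
    (fun y p hp p' hp' h => by
      simp only [PBond.mk.injEq] at h
      exact Prod.ext h.2 (chart_injective hi y h.1)) y f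

/-- The same summed over all blocks, against ALL bonds of the torus (constant `L(L−1)/2`). [folklore] -/
private theorem sum_var_block_le (hi : i + 1 ≤ P.m + P.K) (f : Balaban1983to89.Site P i → ℝ) :
    ∑ y : Balaban1983to89.Site P (i+1), ∑ x ∈ block y, (f x - avg (block y) f) ^ 2
      ≤ (P.L : ℝ) * ((P.L : ℝ) - 1) / 2 * ∑ b : PBond P i, (f b.tgt - f b.src) ^ 2 := by
  have hC' : ((P.L - 1 : ℕ) : ℝ) * ((P.L - 1 : ℕ) + 1) / 2 = (P.L : ℝ) * ((P.L : ℝ) - 1) / 2 := by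
    rw [Nat.cast_pred P.L_pos]; ring
  have hC : 0 ≤ (P.L : ℝ) * ((P.L : ℝ) - 1) / 2 := by rw [← hC']; positivity
  calc ∑ y : Balaban1983to89.Site P (i+1), ∑ x ∈ block y, (f x - avg (block y) f) ^ 2
      ≤ ∑ y : Balaban1983to89.Site P (i+1), (P.L : ℝ) * ((P.L : ℝ) - 1) / 2 *
          ∑ b ∈ univ.filter (fun b : PBond P i => blockOf b.src = y), (f b.tgt - f b.src) ^ 2 := by
        refine sum_le_sum fun y _ => ((var_block_le hi y f).trans_eq (by rw [hC'])).trans (mul_le_mul_of_nonneg_left ?_ hC)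
        exact sum_le_sum_of_subset_of_nonneg (fun b hb => by simp only [mem_filter, mem_univ, true_and] at hb ⊢; exact hb.1)
          fun _ _ _ => sq_nonneg _
    _ = (P.L : ℝ) * ((P.L : ℝ) - 1) / 2 * ∑ b : PBond P i, (f b.tgt - f b.src) ^ 2 := by
        rw [← mul_sum, sum_fiberwise univ (fun b : PBond P i => blockOf b.src)]

/-- At the flat background the covariant average (2.6) is the plain block mean `L^{−d}Σ_{x∈B(y)}φ(x)`: its real and imaginary parts are
the block means of those of `φ`. [folklore] -/
private theorem re_im_qlin_one (hi : i + 1 ≤ P.m + P.K) (φ : FineSp P i) (y : Balaban1983to89.Site P (i+1)) :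
    (Qlin (1 : GaugeField P i U1) φ y).re = avg (block y) (fun x => (φ x).re)
      ∧ (Qlin (1 : GaugeField P i U1) φ y).im = avg (block y) (fun x => (φ x).im) := by
  have h1 : Qlin (1 : GaugeField P i U1) φ y = ((((P.L : ℝ) ^ P.d)⁻¹ : ℝ) : ℂ) * ∑ x ∈ block y, φ x := by
    rw [Qlin_apply, qCov_apply, sum_congr rfl fun x _ => by rw [holC_of_deltaAx hi deltaAx_one, one_mul]]
    push_cast
    rfl
  rw [h1, Complex.re_ofReal_mul, Complex.re_sum, Complex.im_ofReal_mul, Complex.im_sum, avg, avg,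
    Balaban1983to89.Site.card_block hi, Nat.cast_pow, div_eq_inv_mul, div_eq_inv_mul]
  exact ⟨rfl, rfl⟩

/-- **THE ONE-LEVEL BLOCK POINCARÉ INEQUALITY ON THE TORUS** `T^{(i)}` (`i + 1 ≤ m + K`, blocks of side `L`): for every complex field `φ`,
`‖φ‖² ≤ L^d·‖Q(1)φ‖² + (L(L−1)/2)·Σ_b |φ(b₊) − φ(b₋)|²` — on each block `Σ_{x∈B(y)}|φ(x)|² = L^d|(Q(1)φ)(y)|² + Σ_{x∈B(y)}|φ(x) − (Q(1)φ)(y)|²`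
(Steiner) and the deviation from the block mean is bounded by the cube Poincaré inequality (`Beta.CoordCubePoincare`, constant `(L−1)L/2`)
against the bonds inside the block.  Kernel mechanism of the lower bound (2.33) at `A = 0`. [cite: Balaban1982Higgs1, (2.33) p.611] -/
theorem norm_sq_le_blockAvg_add_bondSum (hi : i + 1 ≤ P.m + P.K) (φ : FineSp P i) :
    ‖φ‖ ^ 2 ≤ (P.L : ℝ) ^ P.d * ‖Qlin (1 : GaugeField P i U1) φ‖ ^ 2
      + (P.L : ℝ) * ((P.L : ℝ) - 1) / 2 * ∑ b : PBond P i, ‖φ b.tgt - φ b.src‖ ^ 2 := by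
  set fR : Balaban1983to89.Site P i → ℝ := fun x => (φ x).re with hfR
  set fI : Balaban1983to89.Site P i → ℝ := fun x => (φ x).im with hfI
  have hnorm : ‖φ‖ ^ 2 = ∑ y : Balaban1983to89.Site P (i+1), ∑ x ∈ block y, (fR x ^ 2 + fI x ^ 2) := by
    calc ‖φ‖ ^ 2 = ∑ x : Balaban1983to89.Site P i, ‖φ x‖ ^ 2 := (sum_norm_sq_eq φ).symm
      _ = ∑ y : Balaban1983to89.Site P (i+1), ∑ x ∈ block y, ‖φ x‖ ^ 2 :=
          (sum_fiberwise univ (fun x : Balaban1983to89.Site P i => blockOf x) (fun x => ‖φ x‖ ^ 2)).symm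
      _ = _ := sum_congr rfl fun y _ => sum_congr rfl fun x _ => by
          rw [Complex.sq_norm, Complex.normSq_apply, hfR, hfI]; ring
  have hQ : ∀ y : Balaban1983to89.Site P (i+1),
      ((block y).card : ℝ) * avg (block y) fR ^ 2 + ((block y).card : ℝ) * avg (block y) fI ^ 2
        = (P.L : ℝ) ^ P.d * ‖Qlin (1 : GaugeField P i U1) φ y‖ ^ 2 := by
    intro y
    rw [Balaban1983to89.Site.card_block hi, Nat.cast_pow, Complex.sq_norm, Complex.normSq_apply, (re_im_qlin_one hi φ y).1,
      (re_im_qlin_one hi φ y).2, hfR, hfI]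
    ring
  have hbond : ∑ b : PBond P i, ‖φ b.tgt - φ b.src‖ ^ 2
      = ∑ b : PBond P i, (fR b.tgt - fR b.src) ^ 2 + ∑ b : PBond P i, (fI b.tgt - fI b.src) ^ 2 := by
    rw [← sum_add_distrib]
    exact sum_congr rfl fun b _ => by rw [Complex.sq_norm, Complex.normSq_apply, Complex.sub_re, Complex.sub_im, hfR, hfI]; ring
  have hvarR := sum_var_block_le hi fR
  have hvarI := sum_var_block_le hi fI
  calc ‖φ‖ ^ 2 = ∑ y : Balaban1983to89.Site P (i+1), (∑ x ∈ block y, (fR x - avg (block y) fR) ^ 2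
          + ∑ x ∈ block y, (fI x - avg (block y) fI) ^ 2)
        + ∑ y : Balaban1983to89.Site P (i+1), (P.L : ℝ) ^ P.d * ‖Qlin (1 : GaugeField P i U1) φ y‖ ^ 2 := by
        rw [hnorm, ← sum_add_distrib]
        refine sum_congr rfl fun y _ => ?_
        rw [sum_add_distrib, sum_sq_eq_var_add (block y) fR, sum_sq_eq_var_add (block y) fI, ← hQ y]
        ring
    _ ≤ (P.L : ℝ) * ((P.L : ℝ) - 1) / 2 * ∑ b : PBond P i, (fR b.tgt - fR b.src) ^ 2
        + (P.L : ℝ) * ((P.L : ℝ) - 1) / 2 * ∑ b : PBond P i, (fI b.tgt - fI b.src) ^ 2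
        + (P.L : ℝ) ^ P.d * ‖Qlin (1 : GaugeField P i U1) φ‖ ^ 2 := by
        rw [sum_add_distrib, ← mul_sum, sum_norm_sq_eq (Qlin (1 : GaugeField P i U1) φ)]
        linarith [hvarR, hvarI]
    _ = _ := by rw [hbond]; ring

/-! ## §2. (2.33) at the flat background: the uniform lower bound γ₀ -/

/-- **The constant `γ₀ = γ₀(a, a′, d, L)` of (2.33) at the flat background**: `min(a′/L^d, 2·min(a/(9d), ½)/(L(L−1)))` (`a` the Gaussian
constant of the averaging, `a′` that of the next one — `aL^{−2}` in print). [cite: Balaban1982Higgs1, (2.33) p.611] -/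
def gamma0 (a a' : ℝ) (d L : ℕ) : ℝ :=
  min (a' / (L : ℝ) ^ d) (2 * min (a / (9 * d)) (1 / 2) / ((L : ℝ) * ((L : ℝ) - 1)))

/-- `γ₀ > 0` (*"positive constants … γ₀, γ₁"*) for `a, a′ > 0`, `d ≥ 1`, `L ≥ 2`. [cite: Balaban1982Higgs1, (2.33) p.611] -/
theorem gamma0_pos {a a' : ℝ} (ha : 0 < a) (ha' : 0 < a') {d L : ℕ} (hd : 0 < d) (hL : 1 < L) : 0 < gamma0 a a' d L := by
  have hL' : (1 : ℝ) < L := by exact_mod_cast hL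
  have hd' : (0 : ℝ) < d := by exact_mod_cast hd
  exact lt_min (by positivity) (div_pos (mul_pos two_pos (lt_min (by positivity) one_half_pos)) (mul_pos (by linarith) (by linarith)))

variable {j : ℕ}

/-- **(2.33), LOWER BOUND, AT THE FLAT BACKGROUND — UNIFORM IN `k ≥ 1`, IN `j` AND IN THE VOLUME** (C1 p. 301: *"uniform stability
estimates (strictly positive lower bounds)"*): on the torus model, for `1 ≤ k`, `j + k + 1 ≤ m + K`, `a, a′ > 0`, `G = G_k(1)` the inverse of
(4.6.2) at `u = 1` (physical normalization, printed `a_k`) and every unit-lattice field `ψ`: `γ₀‖ψ‖² ≤ a′‖Q(1)ψ‖² + ⟨ψ, Δ_k(1)ψ⟩` —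
the block Poincaré inequality `norm_sq_le_blockAvg_add_bondSum` plus (7.3.2) at the flat background (`BIJ85Ineq732Flat.ineq732_flat_phys`:
`min(a/(9d), ½)·Σ_b|ψ(b₊) − ψ(b₋)|² ≤ ⟨ψ, Δ_k(1)ψ⟩`). [cite: Balaban1982Higgs1, (2.33) p.611] -/
theorem coercive_flat {k : ℕ} (hk1 : 1 ≤ k) (hk : j + k + 1 ≤ P.m + P.K) {a a' : ℝ} (ha : 0 < a) (ha' : 0 < a')
    {G : FineSp P j →ₗ[ℝ] FineSp P j}
    (hG : ∀ φ, opT (Dlin (cPhys P k) (1 : GaugeField P j U1)) (QlinK (1 : GaugeField P j U1) k)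
      (BIJ85Sect4Statements.aK a P.L k) (G φ) = φ)
    (ψ : CoarseSpK P j k) :
    gamma0 a a' P.d P.L * ‖ψ‖ ^ 2
      ≤ a' * ‖Qlin (1 : GaugeField P (j+k) U1) ψ‖ ^ 2
        + ⟪ψ, deltaOp (QlinK (1 : GaugeField P j U1) k) (BIJ85Sect4Statements.aK a P.L k) G ψ⟫ := by
  have hP := norm_sq_le_blockAvg_add_bondSum (i := j + k) hk ψ
  have h732 := ineq732_flat_phys hk1 (by omega) ha hG ψ
  rw [bondForm_one] at h732
  set γ := min (a / (9 * P.d)) (1 / 2)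
  set g := gamma0 a a' P.d P.L with hg
  set S := ∑ b : PBond P (j+k), ‖ψ b.tgt - ψ b.src‖ ^ 2
  set N := (P.L : ℝ) ^ P.d
  have hL : (1 : ℝ) < P.L := by linarith [three_le_L P]
  have hLL : (0 : ℝ) < (P.L : ℝ) * ((P.L : ℝ) - 1) := mul_pos (by linarith) (by linarith)
  have hg0 : 0 ≤ g := (gamma0_pos ha ha' P.hd P.hL.2).le
  have h1 : g * N ≤ a' := (le_div_iff₀ (by positivity)).1 (min_le_left _ _)
  have h2 : g * ((P.L : ℝ) * ((P.L : ℝ) - 1) / 2) ≤ γ := by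
    have h := min_le_right (a' / N) (2 * γ / ((P.L : ℝ) * ((P.L : ℝ) - 1)))
    calc g * ((P.L : ℝ) * ((P.L : ℝ) - 1) / 2) ≤ 2 * γ / ((P.L : ℝ) * ((P.L : ℝ) - 1)) * ((P.L : ℝ) * ((P.L : ℝ) - 1) / 2) :=
          mul_le_mul_of_nonneg_right h (by positivity)
      _ = γ := by
          have hL1 : (P.L : ℝ) - 1 ≠ 0 := ne_of_gt (by linarith)
          field_simp
  have hS : 0 ≤ S := sum_nonneg fun _ _ => sq_nonneg _
  calc g * ‖ψ‖ ^ 2 ≤ g * (N * ‖Qlin (1 : GaugeField P (j+k) U1) ψ‖ ^ 2 + (P.L : ℝ) * ((P.L : ℝ) - 1) / 2 * S) :=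
        mul_le_mul_of_nonneg_left hP hg0
    _ = g * N * ‖Qlin (1 : GaugeField P (j+k) U1) ψ‖ ^ 2 + g * ((P.L : ℝ) * ((P.L : ℝ) - 1) / 2) * S := by ring
    _ ≤ a' * ‖Qlin (1 : GaugeField P (j+k) U1) ψ‖ ^ 2 + γ * S :=
        add_le_add (mul_le_mul_of_nonneg_right h1 (sq_nonneg _)) (mul_le_mul_of_nonneg_right h2 hS)
    _ ≤ _ := by linarith [h732]

/-- **(2.33), lower bound, for the operator `a′Q(1^{(k)})^*Q(1^{(k)}) + Δ_k(1)` inverted in (2.31)** (`BIJ85FluctuationCovariance.covOp`; `1^{(k)} = 1`,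
`lineIter_one`): `γ₀‖ψ‖² ≤ ⟨ψ, (a′Q^*Q + Δ_k(1))ψ⟩`. [cite: Balaban1982Higgs1, (2.33) p.611] -/
theorem coercive_covOp_flat {k : ℕ} (hk1 : 1 ≤ k) (hk : j + k + 1 ≤ P.m + P.K) {a a' : ℝ} (ha : 0 < a) (ha' : 0 < a')
    {G : FineSp P j →ₗ[ℝ] FineSp P j}
    (hG : ∀ φ, opT (Dlin (cPhys P k) (1 : GaugeField P j U1)) (QlinK (1 : GaugeField P j U1) k)
      (BIJ85Sect4Statements.aK a P.L k) (G φ) = φ)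
    (ψ : CoarseSpK P j k) :
    gamma0 a a' P.d P.L * ‖ψ‖ ^ 2
      ≤ ⟪ψ, covOp (QlinK (1 : GaugeField P j U1) k) (BIJ85Sect4Statements.aK a P.L k) G
          (Qlin (lineIter (1 : GaugeField P j U1) k)) a' ψ⟫ := by
  rw [inner_covOp, lineIter_one]
  exact coercive_flat hk1 hk ha ha' hG ψ

/-! ## §3. (2.33) upper bound, at every background -/

/-- Jensen: `|Σ_{x∈S} g(x)|² ≤ |S|·Σ_{x∈S}|g(x)|²`. [folklore] -/
private theorem norm_sum_sq_le_card_mul {ι : Type*} (S : Finset ι) (g : ι → ℂ) :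
    ‖∑ x ∈ S, g x‖ ^ 2 ≤ S.card * ∑ x ∈ S, ‖g x‖ ^ 2 :=
  calc ‖∑ x ∈ S, g x‖ ^ 2 ≤ (∑ x ∈ S, ‖g x‖) ^ 2 := pow_le_pow_left₀ (norm_nonneg _) (norm_sum_le _ _) 2
    _ ≤ S.card * ∑ x ∈ S, ‖g x‖ ^ 2 := sq_sum_le_card_mul_sum_sq

/-- **`‖Q(W)φ‖² ≤ L^{−d}‖φ‖²` for EVERY transport field `W`** (the transports have modulus one, Jensen on each block of `L^d` sites) —
(2.9) *"Q is a partial isometry"* read in the unweighted `ℓ²` norms of the carriers (the weights (2.2) absorb `L^{−d}`).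
[cite: BalabanImbrieJaffe1985, (2.9) p.303] -/
theorem norm_Qlin_sq_le (hi : i + 1 ≤ P.m + P.K) (W : GaugeField P i U1) (φ : FineSp P i) :
    ‖Qlin W φ‖ ^ 2 ≤ ((P.L : ℝ) ^ P.d)⁻¹ * ‖φ‖ ^ 2 := by
  have hLd : (0 : ℝ) < (P.L : ℝ) ^ P.d := by have := three_le_L P; positivity
  rw [← sum_norm_sq_eq (Qlin W φ), ← sum_norm_sq_eq φ,
    ← sum_fiberwise univ (fun x : Balaban1983to89.Site P i => blockOf x) (fun x => ‖φ x‖ ^ 2), mul_sum]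
  refine sum_le_sum fun y _ => ?_
  have h := norm_sum_sq_le_card_mul (block y) (fun x => holC W x * (WithLp.ofLp φ) x)
  rw [Balaban1983to89.Site.card_block hi, Nat.cast_pow] at h
  have h' : ∑ x ∈ block y, ‖holC W x * (WithLp.ofLp φ) x‖ ^ 2 = ∑ x ∈ block y, ‖φ x‖ ^ 2 :=
    sum_congr rfl fun x _ => by rw [norm_mul, norm_holC, one_mul]
  rw [h'] at h
  rw [Qlin_apply, qCov_apply, norm_mul, mul_pow, norm_inv, norm_pow, Complex.norm_natCast]
  calc ((P.L : ℝ) ^ P.d)⁻¹ ^ 2 * ‖∑ x ∈ block y, holC W x * (WithLp.ofLp φ) x‖ ^ 2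
      ≤ ((P.L : ℝ) ^ P.d)⁻¹ ^ 2 * ((P.L : ℝ) ^ P.d * ∑ x ∈ block y, ‖φ x‖ ^ 2) :=
        mul_le_mul_of_nonneg_left h (by positivity)
    _ = ((P.L : ℝ) ^ P.d)⁻¹ * ∑ x ∈ block y, ‖φ x‖ ^ 2 := by field_simp

/-- **(2.33), UPPER BOUND, AT EVERY BACKGROUND**: for every `u`, every transport field `W` of the next averaging, `a_k, a′ ≥ 0`, `G` the inverse
of (4.6.2): `a′‖Q(W)ψ‖² + ⟨ψ, Δ_k(u)ψ⟩ ≤ (a′L^{−d} + a_k)‖ψ‖²` (`norm_Qlin_sq_le` + `BIJ85BlockAveragingIneq.inner_deltaOp_le`), i.e.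
`γ₁ = a′L^{−d} + a_k ≤ a′ + a`. [cite: Balaban1982Higgs1, (2.33) p.611] -/
theorem form_le {k : ℕ} (hk : j + k + 1 ≤ P.m + P.K) {c a a' : ℝ} (ha : 0 ≤ a) (ha' : 0 ≤ a') (U : GaugeField P j U1)
    (W : GaugeField P (j+k) U1) {G : FineSp P j →ₗ[ℝ] FineSp P j} (hG : ∀ φ, opT (Dlin c U) (QlinK U k) a (G φ) = φ)
    (ψ : CoarseSpK P j k) :
    a' * ‖Qlin W ψ‖ ^ 2 + ⟪ψ, deltaOp (QlinK U k) a G ψ⟫ ≤ (a' * ((P.L : ℝ) ^ P.d)⁻¹ + a) * ‖ψ‖ ^ 2 := by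
  have h1 := norm_Qlin_sq_le (i := j + k) hk W ψ
  have h2 := inner_deltaOp_le (D := Dlin c U) hG ha ψ
  nlinarith [mul_le_mul_of_nonneg_left h1 ha']

/-! ## §4. Consequences for the fluctuation covariance `C^{(k)}(1)` -/

section Abstract

variable {Φ₁ : Type*} [NormedAddCommGroup Φ₁] [InnerProductSpace ℝ Φ₁]

/-- Coercivity `γ‖χ‖² ≤ ⟨χ, Tχ⟩` and `TC = 1` give `‖Cψ‖ ≤ γ^{−1}‖ψ‖`. [folklore] -/
private theorem norm_inv_le {T C : Φ₁ →ₗ[ℝ] Φ₁} {γ : ℝ} (hγ : 0 < γ) (hco : ∀ χ, γ * ‖χ‖ ^ 2 ≤ ⟪χ, T χ⟫)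
    (hC : ∀ ψ, T (C ψ) = ψ) (ψ : Φ₁) : ‖C ψ‖ ≤ γ⁻¹ * ‖ψ‖ := by
  have h : γ * ‖C ψ‖ ^ 2 ≤ ‖C ψ‖ * ‖ψ‖ := by simpa only [hC] using (hco (C ψ)).trans (real_inner_le_norm _ _)
  rw [inv_mul_eq_div, le_div_iff₀ hγ]
  by_cases h0 : C ψ = 0
  · rw [h0, norm_zero, zero_mul]; positivity
  · nlinarith [norm_pos_iff.2 h0]

/-- Cauchy–Schwarz for the non-negative symmetric form `⟨·, T·⟩`. [folklore] -/
private theorem form_cauchySchwarz {T : Φ₁ →ₗ[ℝ] Φ₁} (hTs : ∀ x y, ⟪T x, y⟫ = ⟪x, T y⟫) (hT0 : ∀ x, 0 ≤ ⟪x, T x⟫)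
    (u v : Φ₁) : ⟪u, T v⟫ ^ 2 ≤ ⟪u, T u⟫ * ⟪v, T v⟫ := by
  have key : ∀ t : ℝ, 0 ≤ ⟪v, T v⟫ * (t * t) + -(2 * ⟪u, T v⟫) * t + ⟪u, T u⟫ := by
    intro t
    have h := hT0 (u - t • v)
    have hvu : ⟪v, T u⟫ = ⟪u, T v⟫ := by rw [← hTs, real_inner_comm]
    rw [map_sub, map_smul, inner_sub_left, inner_sub_right, inner_sub_right, real_inner_smul_left, real_inner_smul_left,
      real_inner_smul_right, real_inner_smul_right, hvu] at h
    linarith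
  have hd := discrim_le_zero key
  rw [discrim] at hd
  nlinarith [hd]

/-- `0 ≤ T ≤ γ₁` in the form sense, `T` symmetric ⇒ `‖Tχ‖² ≤ γ₁⟨χ, Tχ⟩`. [folklore] -/
private theorem norm_sq_le_of_form_le {T : Φ₁ →ₗ[ℝ] Φ₁} (hTs : ∀ x y, ⟪T x, y⟫ = ⟪x, T y⟫) (hT0 : ∀ x, 0 ≤ ⟪x, T x⟫)
    {γ₁ : ℝ} (hγ₁ : 0 ≤ γ₁) (hle : ∀ x, ⟪x, T x⟫ ≤ γ₁ * ‖x‖ ^ 2) (χ : Φ₁) : ‖T χ‖ ^ 2 ≤ γ₁ * ⟪χ, T χ⟫ := by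
  have h1 : ‖T χ‖ ^ 2 = ⟪χ, T (T χ)⟫ := by rw [← real_inner_self_eq_norm_sq, hTs]
  have h2 := form_cauchySchwarz hTs hT0 χ (T χ)
  rw [← h1] at h2
  have h3 := hle (T χ)
  by_cases h0 : ‖T χ‖ ^ 2 = 0
  · rw [h0]; exact mul_nonneg hγ₁ (hT0 χ)
  · have hpos : 0 < ‖T χ‖ ^ 2 := lt_of_le_of_ne (sq_nonneg _) (Ne.symm h0)
    have h4 : (‖T χ‖ ^ 2) ^ 2 ≤ ⟪χ, T χ⟫ * (γ₁ * ‖T χ‖ ^ 2) :=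
      h2.trans (mul_le_mul_of_nonneg_left h3 (hT0 χ))
    nlinarith

/-- Sandwich for a right inverse: `T` symmetric, `γ₀ ≤ T ≤ γ₁`, `TC = 1` ⇒ `γ₁^{−1}‖ψ‖² ≤ ⟨ψ, Cψ⟩ ≤ γ₀^{−1}‖ψ‖²`. [folklore] -/
private theorem inner_inv_bounds {T C : Φ₁ →ₗ[ℝ] Φ₁} (hTs : ∀ x y, ⟪T x, y⟫ = ⟪x, T y⟫) {γ₀ γ₁ : ℝ} (hγ₀ : 0 < γ₀)
    (hγ₁ : 0 < γ₁) (hco : ∀ χ, γ₀ * ‖χ‖ ^ 2 ≤ ⟪χ, T χ⟫) (hle : ∀ x, ⟪x, T x⟫ ≤ γ₁ * ‖x‖ ^ 2)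
    (hC : ∀ ψ, T (C ψ) = ψ) (ψ : Φ₁) : γ₁⁻¹ * ‖ψ‖ ^ 2 ≤ ⟪ψ, C ψ⟫ ∧ ⟪ψ, C ψ⟫ ≤ γ₀⁻¹ * ‖ψ‖ ^ 2 := by
  have hT0 : ∀ x, 0 ≤ ⟪x, T x⟫ := fun x => (mul_nonneg hγ₀.le (sq_nonneg _)).trans (hco x)
  have hsym : ⟪ψ, C ψ⟫ = ⟪C ψ, T (C ψ)⟫ := by rw [hC, real_inner_comm]
  constructor
  · have h := norm_sq_le_of_form_le hTs hT0 hγ₁.le hle (C ψ)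
    rw [← hsym, hC] at h
    rw [inv_mul_eq_div, div_le_iff₀ hγ₁]
    linarith
  · have h1 := norm_inv_le hγ₀ hco hC ψ
    calc ⟪ψ, C ψ⟫ ≤ ‖ψ‖ * ‖C ψ‖ := real_inner_le_norm _ _
      _ ≤ ‖ψ‖ * (γ₀⁻¹ * ‖ψ‖) := mul_le_mul_of_nonneg_left h1 (norm_nonneg _)
      _ = γ₀⁻¹ * ‖ψ‖ ^ 2 := by ring

end Abstract

/-- **`‖C^{(k)}(1)‖ ≤ γ₀^{−1}` UNIFORMLY IN `k ≥ 1`, `j` AND THE VOLUME**: every right inverse `C` of `a′Q^*Q + Δ_k(1)` (the fluctuation covariance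
(2.31) at the flat background; it exists, `BIJ85FluctuationCovariance.exists_C`) satisfies `‖Cψ‖ ≤ γ₀^{−1}‖ψ‖`.
[cite: Balaban1982Higgs1, (2.33) p.611] -/
theorem norm_C_le_flat {k : ℕ} (hk1 : 1 ≤ k) (hk : j + k + 1 ≤ P.m + P.K) {a a' : ℝ} (ha : 0 < a) (ha' : 0 < a')
    {G : FineSp P j →ₗ[ℝ] FineSp P j}
    (hG : ∀ φ, opT (Dlin (cPhys P k) (1 : GaugeField P j U1)) (QlinK (1 : GaugeField P j U1) k)
      (BIJ85Sect4Statements.aK a P.L k) (G φ) = φ)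
    {C : CoarseSpK P j k →ₗ[ℝ] CoarseSpK P j k}
    (hC : ∀ ψ, covOp (QlinK (1 : GaugeField P j U1) k) (BIJ85Sect4Statements.aK a P.L k) G
      (Qlin (lineIter (1 : GaugeField P j U1) k)) a' (C ψ) = ψ)
    (ψ : CoarseSpK P j k) : ‖C ψ‖ ≤ (gamma0 a a' P.d P.L)⁻¹ * ‖ψ‖ :=
  norm_inv_le (gamma0_pos ha ha' P.hd P.hL.2) (coercive_covOp_flat hk1 hk ha ha' hG) hC ψ

/-- **`γ₁^{−1} ≤ C^{(k)}(1) ≤ γ₀^{−1}` IN THE FORM SENSE**, `γ₁ = a′L^{−d} + a_k`, uniformly in `k ≥ 1`, `j` and the volume: the inverse form of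
(2.33) at the flat background, for every right inverse `C` of `a′Q^*Q + Δ_k(1)` (symmetric operator: `covOp_symm` with p30's `inverse_symm`).
[cite: Balaban1982Higgs1, (2.33) p.611] -/
theorem inner_C_bounds_flat {k : ℕ} (hk1 : 1 ≤ k) (hk : j + k + 1 ≤ P.m + P.K) {a a' : ℝ} (ha : 0 < a) (ha' : 0 < a')
    {G : FineSp P j →ₗ[ℝ] FineSp P j}
    (hG : ∀ φ, opT (Dlin (cPhys P k) (1 : GaugeField P j U1)) (QlinK (1 : GaugeField P j U1) k)
      (BIJ85Sect4Statements.aK a P.L k) (G φ) = φ)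
    {C : CoarseSpK P j k →ₗ[ℝ] CoarseSpK P j k}
    (hC : ∀ ψ, covOp (QlinK (1 : GaugeField P j U1) k) (BIJ85Sect4Statements.aK a P.L k) G
      (Qlin (lineIter (1 : GaugeField P j U1) k)) a' (C ψ) = ψ)
    (ψ : CoarseSpK P j k) :
    (a' * ((P.L : ℝ) ^ P.d)⁻¹ + BIJ85Sect4Statements.aK a P.L k)⁻¹ * ‖ψ‖ ^ 2 ≤ ⟪ψ, C ψ⟫
      ∧ ⟪ψ, C ψ⟫ ≤ (gamma0 a a' P.d P.L)⁻¹ * ‖ψ‖ ^ 2 := by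
  have hL : (1 : ℝ) < P.L := by linarith [three_le_L P]
  have haK := (BIJ85CoefficientAk464.aK_pos_le ha hL hk1).1
  have hLd : (0 : ℝ) < ((P.L : ℝ) ^ P.d)⁻¹ := by positivity
  refine inner_inv_bounds
    (covOp_symm (QlinK (1 : GaugeField P j U1) k) _ (inverse_symm (Dlin (cPhys P k) 1) (QlinK 1 k) _ G hG) _ a')
    (gamma0_pos ha ha' P.hd P.hL.2) (by positivity) (coercive_covOp_flat hk1 hk ha ha' hG) (fun x => ?_) hC ψ
  rw [inner_covOp]
  exact form_le hk haK.le ha'.le 1 _ hG x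

end

end Literature.MathematicalPhysics.QuantumFieldTheory.BalabanImbrieJaffe1984to88.BIJ85FluctuationCovarianceFlatBounds
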